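/-
Origin: expansion seat `literature-prover-pub-hodgecm-cf-hasseminkowski-g7-0`, handover #7 v2 DOC-ONLY REPLACEMENT of the RUN-28 tree copy (source a3bef7b4 → 49c35911, 390 l.; one `## References` bullet re-worded with chunk locators p0104 L20 / p0105 L17, L21, L27; code lines identical; imports: no rewrite; zero urgency) (`HOME/pub-hodgecm-cf-hasseminkowski-g7/lean/staged-r29/OMeara661Algebra.lean`, md5 49c35911, 390 lines);
landed by the gen-8 packager in gate run 29 REPLACES the earlier landed copy of `HodgeCM/Literature/OMeara661Algebra.lean` (verbatim).
-/
/-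
Copyright: pub-hodgecm formalisation cell (harness21, 2026). New file (not vendored).
Origin: CITED-FACT seat (4) `literature-prover-pub-hodgecm-cf-hasseminkowski-g7-0` (unit pub-hodgecm-cf-hasseminkowski-g7),
2026-08-18; proposed place `HodgeCM/Literature/OMeara661Algebra.lean` (WIP module `CfHM7.OMeara661Algebra`).
-/
import Summits.HodgeConjecture.HodgeCM.Literature.HasseMinkowski
import Literature.NumberTheory.QuadraticForms.HilbertSymbolLocalRepresentation

/-!
# Algebraic lemmas on isotropy of diagonal forms (for O'Meara 66:1)

Pure field algebra used by the proof of `HodgeCM.Literature.OMeara_66_1_holds` (O'Meara, *Introduction to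
Quadratic Forms*, Grundlehren 117 (1963), §66 Thm 66:1 pp. 186–188), stated for the package's vocabulary
`HodgeCM.Literature.DiagIsotropic c` (`= ∃ x ≠ 0, ∑ cᵢ xᵢ² = 0`):

* bookkeeping: isotropy of a sub-form (along an injective re-indexing) gives isotropy of the form
  (`DiagIsotropic.of_comp_injective`); an isotropic REGULAR diagonal form over a field of characteristic
  `≠ 2` represents every element (`DiagIsotropic.exists_sum_eq`; O'Meara 42:10 "a regular isotropic space is
  universal", Serre IV §1.6 Prop. 3');
* the binary case: `⟨c₀, c₁⟩` is isotropic iff `-c₀c₁` is a square (`diagIsotropic_two_iff_isSquare`;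
  O'Meara 42:9 / proof of 66:1 step 2), "`dV = -1`");
* the ternary case in Hilbert-symbol form: `⟨c₀, c₁, c₂⟩` is isotropic iff `(-c₀/c₂, -c₁/c₂)_F = 1`
  (`diagIsotropic_three_iff_hilbertSymbol`; O'Meara proof of 66:1 step 3), "`α = ξ² - θη²`");
* **42:12-type lemma** (`diagIsotropic_three_of_four_of_isSquare_disc`): a regular isotropic quaternary diagonal
  space whose discriminant is a square has its ternary sub-space `⟨c₀,c₁,c₂⟩` isotropic (O'Meara 42:12 via
  "a regular ternary space representing `-disc` is isotropic", `diagIsotropic_three_of_eq_neg_disc`);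
* **58:7-type descent** (`diagIsotropic_four_of_ternary_descent`): if `x, y ∈ F³`, not both `0`, satisfy
  `B(x,y) = 0` and `T(x) = -D·T(y)` for `T = ⟨c₀,c₁,c₂⟩`, `D = c₀c₁c₂c₃`, then `⟨c₀,c₁,c₂,c₃⟩` is isotropic —
  the coordinates of an isotropic vector of `T` over `F(√D)` give such `x, y` (O'Meara proof of 66:1 step 4,
  "Hence `V` is isotropic by Proposition 58:7").

The two last items are proved with the explicit weighted cross product
`z = (c₁c₂(y₁u₂ - y₂u₁), c₀c₂(y₂u₀ - y₀u₂), c₀c₁(y₀u₁ - y₁u₀))`, which is `B`-orthogonal to `y` and `u` and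
has `T(z) = c₀c₁c₂ (T(y)T(u) - B(y,u)²)` (the weighted Lagrange identity) — polynomial identities checked by
`ring`; no orthogonal-complement theory is needed.

## References
* O. T. O'Meara, *Introduction to Quadratic Forms*, Grundlehren 117, Springer 1963: §42D 42:9–42:12 (printed p. 94 ff.
  by the book's Index "Isotropy, 94"; held e-text `corpus:book:o-meara1963-introduction-quadratic-forms` chunks
  p0104 L20 (42:9), p0105 L17 (42:10), L21 (42:11), L27 (42:12)), 58:7, 66:1 (pp. 186–188; chunks p0191–p0193).
* J.-P. Serre, *A Course in Arithmetic*, GTM 7, Ch. IV §1.6 Prop. 3'.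
-/

set_option autoImplicit false

noncomputable section

open Literature.NumberTheory.QuadraticForms

namespace HodgeCM.Literature

namespace DiagIsotropic

variable {A : Type*} [CommRing A] {n m : ℕ}

/-- A diagonal form is isotropic as soon as the sub-form on the image of an injective re-indexing
`e : Fin m → Fin n` is: extend an isotropic vector by zero. -/
theorem of_comp_injective {c : Fin n → A} (e : Fin m → Fin n) (he : Function.Injective e)
    (h : DiagIsotropic (c ∘ e)) : DiagIsotropic c := by
  classical
  obtain ⟨x, hx0, hx⟩ := h
  let y : Fin n → A := Function.extend e x 0
  have hy : ∀ k, y (e k) = x k := fun k => he.extend_apply x 0 k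
  have hy' : ∀ j, (∀ k, e k ≠ j) → y j = 0 := by
    intro j hj
    simp only [y]
    rw [Function.extend_apply' _ _ _ (by rintro ⟨k, rfl⟩; exact hj k rfl)]
    rfl
  refine ⟨y, ?_, ?_⟩
  · intro h
    apply hx0
    funext k
    have := congrFun h (e k)
    rw [hy] at this
    exact this
  · -- the sum over `Fin n` reduces to the sum over the image of `e`
    have hsplit : ∑ j, c j * y j ^ 2 = ∑ j ∈ Finset.univ.image e, c j * y j ^ 2 := by
      symm
      apply Finset.sum_subset (Finset.subset_univ _)
      intro j _ hj
      have : ∀ k, e k ≠ j := by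
        intro k hk
        exact hj (Finset.mem_image.2 ⟨k, Finset.mem_univ _, hk⟩)
      rw [hy' j this]
      ring
    rw [hsplit, Finset.sum_image (fun k _ l _ hkl => he hkl)]
    simp only [Function.comp_apply] at hx
    simpa [hy] using hx

end DiagIsotropic

section Field

variable {F : Type*} [Field F]

/-- **A regular isotropic diagonal form is universal** (O'Meara 42:10; Serre IV §1.6 Prop. 3'): over a field
with `2 ≠ 0`, if `∑ cᵢ xᵢ² = 0` with `x ≠ 0` and all `cᵢ ≠ 0`, then every `t` is represented:
with `x_j ≠ 0`, `f(λ x + e_j) = 2 λ c_j x_j + c_j` equals `t` for `λ = (t - c_j) / (2 c_j x_j)`. -/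
theorem DiagIsotropic.exists_sum_eq [NeZero (2 : F)] {n : ℕ} {c : Fin n → F} (hc : ∀ i, c i ≠ 0)
    (h : DiagIsotropic c) (t : F) : ∃ x : Fin n → F, ∑ i, c i * x i ^ 2 = t := by
  classical
  obtain ⟨x, hx0, hx⟩ := h
  obtain ⟨j, hj⟩ : ∃ j, x j ≠ 0 := by
    by_contra hall
    push Not at hall
    exact hx0 (funext hall)
  have h2 : (2 : F) ≠ 0 := two_ne_zero
  set lam : F := (t - c j) / (2 * c j * x j) with hlam
  refine ⟨fun i => lam * x i + (Pi.single j (1 : F) : Fin n → F) i, ?_⟩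
  have hexp : ∀ i, c i * (lam * x i + (Pi.single j (1 : F) : Fin n → F) i) ^ 2 =
      lam ^ 2 * (c i * x i ^ 2) + 2 * lam * (c i * x i * (Pi.single j (1 : F) : Fin n → F) i) +
        c i * (Pi.single j (1 : F) : Fin n → F) i ^ 2 := fun i => by ring
  simp only [hexp, Finset.sum_add_distrib, ← Finset.mul_sum, hx, mul_zero, zero_add]
  have h1 : ∑ i, c i * x i * (Pi.single j (1 : F) : Fin n → F) i = c j * x j := by
    rw [Finset.sum_eq_single j]
    · simp
    · intro i _ hij
      simp [hij]
    · simp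
  have h3 : ∑ i, c i * (Pi.single j (1 : F) : Fin n → F) i ^ 2 = c j := by
    rw [Finset.sum_eq_single j]
    · simp
    · intro i _ hij
      simp [hij]
    · simp
  have hcj := hc j
  rw [h1, h3, hlam]
  field_simp
  ring

/-- **The binary case** (O'Meara, proof of 66:1 step 2): for `c₀ c₁ ≠ 0`, `⟨c₀, c₁⟩` is isotropic iff
`-c₀c₁` is a square (`c₀x² + c₁y² = 0`, `x ≠ 0` gives `-c₀c₁ = (c₁y/x)²`; conversely `-c₀c₁ = s²` gives the
zero `(s, c₀)`). -/
theorem diagIsotropic_two_iff_isSquare {c : Fin 2 → F} (h0 : c 0 ≠ 0) (h1 : c 1 ≠ 0) :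
    DiagIsotropic c ↔ IsSquare (-(c 0 * c 1)) := by
  constructor
  · rintro ⟨x, hx0, hx⟩
    rw [Fin.sum_univ_two] at hx
    have hx0' : x 0 ≠ 0 := by
      intro h
      rw [h] at hx
      have : x 1 = 0 := by
        have : c 1 * x 1 ^ 2 = 0 := by linear_combination hx
        simpa [h1] using this
      apply hx0
      funext i
      fin_cases i <;> assumption
    refine ⟨c 1 * x 1 / x 0, ?_⟩
    rw [div_mul_div_comm, eq_div_iff (mul_ne_zero hx0' hx0')]
    linear_combination (-(c 1)) * hx
  · rintro ⟨s, hs⟩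
    refine ⟨![s, c 0], ?_, ?_⟩
    · intro h
      have := congrFun h 1
      simp at this
      exact h0 this
    · rw [Fin.sum_univ_two]
      simp only [Matrix.cons_val_zero, Matrix.cons_val_one]
      linear_combination (c 0) * hs.symm

/-- **The ternary case, Hilbert-symbol form** (O'Meara, proof of 66:1 step 3, "`α = ξ² - θη²`"): for
`c₀ c₁ c₂ ≠ 0` over a field with `2 ≠ 0`, `⟨c₀, c₁, c₂⟩` is isotropic iff `(-c₀/c₂) y² + (-c₁/c₂) z² = 1` is
soluble, i.e. iff the Hilbert symbol `(-c₀/c₂, -c₁/c₂)_F` is `1` (if an isotropic vector has third coordinate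
`0`, the isotropic binary `⟨c₀,c₁⟩` is universal). -/
theorem diagIsotropic_three_iff_hilbertSymbol [NeZero (2 : F)] {c : Fin 3 → F} (h0 : c 0 ≠ 0)
    (h1 : c 1 ≠ 0) (h2 : c 2 ≠ 0) :
    DiagIsotropic c ↔ hilbertSymbol F (-(c 0 / c 2)) (-(c 1 / c 2)) = 1 := by
  rw [hilbertSymbol_eq_one_iff]
  constructor
  · rintro ⟨x, hx0, hx⟩
    rw [Fin.sum_univ_three] at hx
    by_cases hx2 : x 2 = 0
    · -- the binary `⟨c₀, c₁⟩` is isotropic, hence universal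
      rw [hx2] at hx
      have hx01 : x 0 ≠ 0 ∨ x 1 ≠ 0 := by
        by_contra hno
        push Not at hno
        apply hx0
        funext i
        fin_cases i
        · exact hno.1
        · exact hno.2
        · exact hx2
      have hzero : c 0 * x 0 ^ 2 + c 1 * x 1 ^ 2 = 0 := by linear_combination hx
      obtain ⟨y, z, hyz⟩ := exists_binary_eq_of_zero h0 h1 hzero hx01 (-c 2)
      refine ⟨y, z, ?_⟩
      field_simp
      linear_combination (-1 : F) * hyz
    · refine ⟨x 0 / x 2, x 1 / x 2, ?_⟩
      field_simp
      linear_combination (-1 : F) * hx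
  · rintro ⟨y, z, hyz⟩
    refine ⟨![y, z, 1], ?_, ?_⟩
    · intro h
      have := congrFun h 2
      simp at this
    · rw [Fin.sum_univ_three]
      simp only [Matrix.cons_val_zero, Matrix.cons_val_one, Matrix.cons_val]
      field_simp at hyz
      linear_combination (-1 : F) * hyz

/-! ### The weighted cross product in dimension three -/

/-- The weighted cross product `z` of `y, u` for the diagonal form `T = ⟨c₀,c₁,c₂⟩`
(`z₀ = c₁c₂(y₁u₂ - y₂u₁)`, `z₁ = c₀c₂(y₂u₀ - y₀u₂)`, `z₂ = c₀c₁(y₀u₁ - y₁u₀)`) is `B_T`-orthogonal to `y`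
and to `u`, and `T(z) = c₀c₁c₂ (T(y) T(u) - B_T(y,u)²)` (weighted Lagrange identity). -/
theorem cross_three_identities (c₀ c₁ c₂ y₀ y₁ y₂ u₀ u₁ u₂ : F) :
    let z₀ := c₁ * c₂ * (y₁ * u₂ - y₂ * u₁)
    let z₁ := c₀ * c₂ * (y₂ * u₀ - y₀ * u₂)
    let z₂ := c₀ * c₁ * (y₀ * u₁ - y₁ * u₀)
    c₀ * z₀ * y₀ + c₁ * z₁ * y₁ + c₂ * z₂ * y₂ = 0 ∧
    c₀ * z₀ * u₀ + c₁ * z₁ * u₁ + c₂ * z₂ * u₂ = 0 ∧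
    c₀ * z₀ ^ 2 + c₁ * z₁ ^ 2 + c₂ * z₂ ^ 2 =
      c₀ * c₁ * c₂ * ((c₀ * y₀ ^ 2 + c₁ * y₁ ^ 2 + c₂ * y₂ ^ 2) * (c₀ * u₀ ^ 2 + c₁ * u₁ ^ 2 + c₂ * u₂ ^ 2) -
        (c₀ * y₀ * u₀ + c₁ * y₁ * u₁ + c₂ * y₂ * u₂) ^ 2) := by
  refine ⟨by ring, by ring, by ring⟩

/-- Helper: a vector `![a₀, a₁, a₂]` with some non-zero entry witnesses `DiagIsotropic c` for `c : Fin 3 → F`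
once `c₀a₀² + c₁a₁² + c₂a₂² = 0`. -/
theorem diagIsotropic_three_of_coords {c : Fin 3 → F} (a₀ a₁ a₂ : F) (hne : a₀ ≠ 0 ∨ a₁ ≠ 0 ∨ a₂ ≠ 0)
    (h : c 0 * a₀ ^ 2 + c 1 * a₁ ^ 2 + c 2 * a₂ ^ 2 = 0) : DiagIsotropic c := by
  refine ⟨![a₀, a₁, a₂], ?_, ?_⟩
  · intro h0
    have e0 := congrFun h0 0
    have e1 := congrFun h0 1
    have e2 := congrFun h0 2
    simp at e0 e1 e2
    rcases hne with h' | h' | h' <;> contradiction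
  · rw [Fin.sum_univ_three]
    simpa using h

/-- **A regular ternary diagonal space representing `-disc · t²` (`t ≠ 0`) is isotropic** (the content of
O'Meara 42:11/42:12 used in the proof of 66:1 step 4: `⟨c₀,c₁,c₂⟩ ≅ ⟨-c₀c₁c₂t²⟩ ⊥ P` forces `dP = -1`, `P` a
hyperbolic plane).  Explicitly: from `y` with `T(y) = -c₀c₁c₂t²` take `u ≠ 0` orthogonal to `y`, then the
weighted cross product `z` of `y, u` has `T(z) = -(c₀c₁c₂ t)² T(u)`, so `c₀c₁c₂t·u + z` is isotropic. -/
theorem diagIsotropic_three_of_eq_neg_disc {c : Fin 3 → F} (h0 : c 0 ≠ 0) (h1 : c 1 ≠ 0) (h2 : c 2 ≠ 0)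
    {y₀ y₁ y₂ t : F} (ht : t ≠ 0)
    (hy : c 0 * y₀ ^ 2 + c 1 * y₁ ^ 2 + c 2 * y₂ ^ 2 = -(c 0 * c 1 * c 2) * t ^ 2) :
    DiagIsotropic c := by
  -- an explicit non-zero `u` with `B(y,u) = 0`
  have key : ∀ u₀ u₁ u₂ : F, (u₀ ≠ 0 ∨ u₁ ≠ 0 ∨ u₂ ≠ 0) →
      c 0 * y₀ * u₀ + c 1 * y₁ * u₁ + c 2 * y₂ * u₂ = 0 → DiagIsotropic c := by
    intro u₀ u₁ u₂ hune horth
    by_cases hTu : c 0 * u₀ ^ 2 + c 1 * u₁ ^ 2 + c 2 * u₂ ^ 2 = 0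
    · exact diagIsotropic_three_of_coords u₀ u₁ u₂ hune hTu
    · obtain ⟨hzy, hzu, hzz⟩ := cross_three_identities (c 0) (c 1) (c 2) y₀ y₁ y₂ u₀ u₁ u₂
      set z₀ := c 1 * c 2 * (y₁ * u₂ - y₂ * u₁) with hz₀
      set z₁ := c 0 * c 2 * (y₂ * u₀ - y₀ * u₂) with hz₁
      set z₂ := c 0 * c 1 * (y₀ * u₁ - y₁ * u₀) with hz₂
      set D : F := c 0 * c 1 * c 2 with hD
      have hD0 : D ≠ 0 := mul_ne_zero (mul_ne_zero h0 h1) h2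
      -- `T(z) = -(D t)² T(u)`
      have hTz : c 0 * z₀ ^ 2 + c 1 * z₁ ^ 2 + c 2 * z₂ ^ 2 =
          -(D * t) ^ 2 * (c 0 * u₀ ^ 2 + c 1 * u₁ ^ 2 + c 2 * u₂ ^ 2) := by
        rw [hzz, horth, hy]
        ring
      refine diagIsotropic_three_of_coords (D * t * u₀ + z₀) (D * t * u₁ + z₁) (D * t * u₂ + z₂) ?_ ?_
      · -- non-zero: otherwise `z = -Dt·u`, so `B(z,u) = -Dt·T(u) ≠ 0`
        by_contra hno
        push Not at hno
        obtain ⟨e0, e1, e2⟩ := hno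
        have hz0' : z₀ = -(D * t * u₀) := by linear_combination e0
        have hz1' : z₁ = -(D * t * u₁) := by linear_combination e1
        have hz2' : z₂ = -(D * t * u₂) := by linear_combination e2
        rw [hz0', hz1', hz2'] at hzu
        have : D * t * (c 0 * u₀ ^ 2 + c 1 * u₁ ^ 2 + c 2 * u₂ ^ 2) = 0 := by
          linear_combination (-1 : F) * hzu
        rcases mul_eq_zero.1 this with h' | h'
        · exact (mul_ne_zero hD0 ht) h'
        · exact hTu h'
      · linear_combination hTz + (2 * D * t) * hzu
  by_cases h01 : y₀ = 0 ∧ y₁ = 0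
  · obtain ⟨hy0, hy1⟩ := h01
    have hy2 : y₂ ≠ 0 := by
      rintro rfl
      rw [hy0, hy1] at hy
      have : (c 0 * c 1 * c 2) * t ^ 2 = 0 := by linear_combination hy
      rcases mul_eq_zero.1 this with h' | h'
      · exact (mul_ne_zero (mul_ne_zero h0 h1) h2) h'
      · exact ht (pow_eq_zero_iff (n := 2) (by norm_num) |>.1 h')
    exact key 0 (c 2 * y₂) (-(c 1 * y₁)) (Or.inr (Or.inl (mul_ne_zero h2 hy2))) (by ring)
  · have hne : c 1 * y₁ ≠ 0 ∨ -(c 0 * y₀) ≠ 0 ∨ (0 : F) ≠ 0 := by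
      by_cases hy0 : y₀ = 0
      · have hy1 : y₁ ≠ 0 := fun h => h01 ⟨hy0, h⟩
        exact Or.inl (mul_ne_zero h1 hy1)
      · exact Or.inr (Or.inl (neg_ne_zero.2 (mul_ne_zero h0 hy0)))
    exact key (c 1 * y₁) (-(c 0 * y₀)) 0 hne (by ring)

/-- **O'Meara 42:12 for diagonal forms**: if `⟨c₀,c₁,c₂,c₃⟩` is regular and isotropic and its discriminant
`c₀c₁c₂c₃` is a non-zero square, then the ternary sub-space `⟨c₀,c₁,c₂⟩` is isotropic (an isotropic vector
with last coordinate `x₃ ≠ 0` makes `⟨c₀,c₁,c₂⟩` represent `-c₃x₃² = -c₀c₁c₂·(s x₃/(c₀c₁c₂))²`). -/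
theorem diagIsotropic_three_of_four_of_isSquare_disc {c : Fin 4 → F} (hc : ∀ i, c i ≠ 0) {s : F}
    (hs : c 0 * c 1 * c 2 * c 3 = s ^ 2) (h : DiagIsotropic c) :
    DiagIsotropic (fun i : Fin 3 => c i.castSucc) := by
  obtain ⟨x, hx0, hx⟩ := h
  rw [Fin.sum_univ_four] at hx
  have h0 := hc 0; have h1 := hc 1; have h2 := hc 2; have h3 := hc 3
  by_cases hx3 : x 3 = 0
  · refine diagIsotropic_three_of_coords (x 0) (x 1) (x 2) ?_ ?_
    · by_contra hno
      push Not at hno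
      apply hx0
      funext i
      fin_cases i
      · exact hno.1
      · exact hno.2.1
      · exact hno.2.2
      · exact hx3
    · change c 0 * x 0 ^ 2 + c 1 * x 1 ^ 2 + c 2 * x 2 ^ 2 = 0
      rw [hx3] at hx
      linear_combination hx
  · have hs0 : s ≠ 0 := by
      rintro rfl
      exact (mul_ne_zero (mul_ne_zero (mul_ne_zero h0 h1) h2) h3) (by simpa using hs)
    refine diagIsotropic_three_of_eq_neg_disc (c := fun i : Fin 3 => c i.castSucc)
      (by exact h0) (by exact h1) (by exact h2)
      (y₀ := x 0) (y₁ := x 1) (y₂ := x 2) (t := s * x 3 / (c 0 * c 1 * c 2))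
      (div_ne_zero (mul_ne_zero hs0 hx3) (mul_ne_zero (mul_ne_zero h0 h1) h2)) ?_
    change c 0 * x 0 ^ 2 + c 1 * x 1 ^ 2 + c 2 * x 2 ^ 2 = -(c 0 * c 1 * c 2) * (s * x 3 / (c 0 * c 1 * c 2)) ^ 2
    field_simp
    linear_combination (c 0 * c 1 * c 2) * hx - (x 3 ^ 2) * hs

/-- **Descent from `F(√D)` for quaternary diagonal forms** (O'Meara 58:7 as used in 66:1 step 4): let
`T = ⟨c₀,c₁,c₂⟩`, `D = c₀c₁c₂c₃`, all `cᵢ ≠ 0`.  If `x, y ∈ F³`, not both zero, satisfy `B_T(x,y) = 0` and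
`T(x) = -D·T(y)` — which is what the two coordinates of `T(x + √D y) = 0` in `F(√D)` say — then
`⟨c₀,c₁,c₂,c₃⟩` is isotropic over `F`: either `T` itself is isotropic, or with `q = T(y) ≠ 0` the weighted cross
product `e` of `x, y` has `T(e) = c₀c₁c₂·T(x)T(y) = -c₃ (c₀c₁c₂ q)²`, so `(e, c₀c₁c₂q)` is an isotropic vector
with non-zero last coordinate. -/
theorem diagIsotropic_four_of_ternary_descent {c : Fin 4 → F} (hc : ∀ i, c i ≠ 0)
    (x₀ x₁ x₂ y₀ y₁ y₂ : F) (hne : ¬ (x₀ = 0 ∧ x₁ = 0 ∧ x₂ = 0 ∧ y₀ = 0 ∧ y₁ = 0 ∧ y₂ = 0))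
    (horth : c 0 * x₀ * y₀ + c 1 * x₁ * y₁ + c 2 * x₂ * y₂ = 0)
    (hval : c 0 * x₀ ^ 2 + c 1 * x₁ ^ 2 + c 2 * x₂ ^ 2 =
      -(c 0 * c 1 * c 2 * c 3) * (c 0 * y₀ ^ 2 + c 1 * y₁ ^ 2 + c 2 * y₂ ^ 2)) :
    DiagIsotropic c := by
  have h0 := hc 0; have h1 := hc 1; have h2 := hc 2; have h3 := hc 3
  -- a zero of `T` with a non-zero coordinate gives a zero of the quaternary form
  have ofT : ∀ a₀ a₁ a₂ : F, (a₀ ≠ 0 ∨ a₁ ≠ 0 ∨ a₂ ≠ 0) →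
      c 0 * a₀ ^ 2 + c 1 * a₁ ^ 2 + c 2 * a₂ ^ 2 = 0 → DiagIsotropic c := by
    intro a₀ a₁ a₂ hane ha
    refine ⟨![a₀, a₁, a₂, 0], ?_, ?_⟩
    · intro h0'
      have e0 := congrFun h0' 0
      have e1 := congrFun h0' 1
      have e2 := congrFun h0' 2
      simp at e0 e1 e2
      rcases hane with h' | h' | h' <;> contradiction
    · rw [Fin.sum_univ_four]
      simp only [Matrix.cons_val_zero, Matrix.cons_val_one, Matrix.cons_val]
      linear_combination ha
  by_cases hq : c 0 * y₀ ^ 2 + c 1 * y₁ ^ 2 + c 2 * y₂ ^ 2 = 0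
  · by_cases hy : y₀ = 0 ∧ y₁ = 0 ∧ y₂ = 0
    · obtain ⟨e0, e1, e2⟩ := hy
      have hx : x₀ ≠ 0 ∨ x₁ ≠ 0 ∨ x₂ ≠ 0 := by
        by_contra hno
        push Not at hno
        exact hne ⟨hno.1, hno.2.1, hno.2.2, e0, e1, e2⟩
      refine ofT x₀ x₁ x₂ hx ?_
      rw [hval, hq, mul_zero]
    · have hy' : y₀ ≠ 0 ∨ y₁ ≠ 0 ∨ y₂ ≠ 0 := by
        by_contra hno
        push Not at hno
        exact hy hno
      exact ofT y₀ y₁ y₂ hy' hq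
  · -- the generic case: the cross product
    obtain ⟨-, -, hzz⟩ := cross_three_identities (c 0) (c 1) (c 2) x₀ x₁ x₂ y₀ y₁ y₂
    set q := c 0 * y₀ ^ 2 + c 1 * y₁ ^ 2 + c 2 * y₂ ^ 2 with hqdef
    set e₀ := c 1 * c 2 * (x₁ * y₂ - x₂ * y₁)
    set e₁ := c 0 * c 2 * (x₂ * y₀ - x₀ * y₂)
    set e₂ := c 0 * c 1 * (x₀ * y₁ - x₁ * y₀)
    have hTe : c 0 * e₀ ^ 2 + c 1 * e₁ ^ 2 + c 2 * e₂ ^ 2 = -c 3 * (c 0 * c 1 * c 2 * q) ^ 2 := by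
      rw [hzz, horth, hval]
      ring
    refine ⟨![e₀, e₁, e₂, c 0 * c 1 * c 2 * q], ?_, ?_⟩
    · intro h0'
      have e3 := congrFun h0' 3
      simp at e3
      rcases e3 with ((e | e) | e) | e
      · exact h0 e
      · exact h1 e
      · exact h2 e
      · exact hq e
    · rw [Fin.sum_univ_four]
      simp only [Matrix.cons_val_zero, Matrix.cons_val_one, Matrix.cons_val]
      linear_combination hTe

end Field

end HodgeCM.Literature

end
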